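import Summits.QuantumFields.BalabanUV.Beta.D1BFx.NeedleRowGlue
import Summits.QuantumFields.BalabanUV.Beta.D1BFx.RoadEndLamRow

/-!
# `BalabanUV.Beta.D1BFx.RoadEndBFxRows` — road «BF-x» for binder row D1, slot (K): THE LABEL OF RECORD `grpRec : RestIdx → Fin 4` (LOCAL ∕ G_Λ ∕
# NEEDLES ∪ G_R ∕ corner) AND **THE `hGrp` HYPOTHESIS OF THE END OF RECORD ASSEMBLED FROM ROWS**: the LOCAL group from ONE n-uniform bound per local
# word, the G_Λ group from `RoadEndLamRow.abs_gLam_row_le_zero_of_letters` (constant `0`, modulo the covariance letters), the needle group from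
# `NeedleRowGlue.abs_gN_row_le_of_tables` (eight table rows) — owner «END-ROWS» (`K-END-RESHAPE-GROUPS.md` §2–§3, `NEEDLE-BOUND-NOTES.md` v1 §5)

HONEST DEPENDENCY (page 1, mandatory): continuum YM on T⁴ ⇐ BetaPertH ∧ nine spine estimates (0/9 proved); BetaPertH ⇐ (D1) ∧ (D4) ∧
CAP+tail; G-an2-4 gates asym, D1 and NE2/3/4.  HONEST FRAMING (cell contract, verbatim): «discharging `BetaPertH` makes Bałaban's UV
stability UNCONDITIONAL — a real constructive-QFT result; it is NOT the continuum limit and NOT the Clay problem.»  THIS MODULE DISCHARGES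
NOTHING of the wall: ONE definition with a body ([our object] `grpRec`, the label of the rest words — DATA) and ONE derived finite set (`localFibre`),
and [folklore] bookkeeping BY NAME over `LamGroupPointwise.lamFibre` (p253437), `NeedleGroupPointwise.needleFibre'` (p255732), `RoadEndBFxRecut.cornerIdx`,
`RoadEndLamRow.abs_gLam_row_le_zero_of_letters` (p255815), `NeedleRowGlue.abs_gN_row_le_of_tables`, `AssemblyEndRecut.conv_recut`, `Assembly.fullSum_finset_sum`.
EVERY analytic input stays DISPLAYED: the local per-word bounds `hLoc`, the Λ-row letters ((W1), (W2′), `hX`, `hTcov`, `cΛ ≠ 0`, `ε = ±1`) and Λ₂-slot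
sockets, the eight needle table rows `h₁ … h₈`.  No `Prop` minted, nothing cited, no printed statement as hypothesis, 0 sorry.  0 wall binders
(root-level hW ∕ hR-sockets ∕ hSX-socket ∕ D1Tel ∕ D1Rep — 0); (K) NOT closed; NOT D1, NOT `BetaPertH`, NOT continuum, NOT Clay.

ABSOLUTE RULE (cell charter, verbatim): «No internally-minted statement may enter as a cited fact. Every hypothesis is either kernel-proved in
this package or a verbatim quotation of a PUBLISHED theorem with page reference. The manuscript(s) under audit are NOT citable for their own
disputed steps — they are the thing under adjudication; programme-internal (2001/route/tribunal) claims are never citable.»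

WHY.  `RoadEndBFxTotalShellGroups.d1Drift_BFx_total_shell_of_prop12_of_groups` (p252741) takes a label `grp : RestIdx → G`, the datum `hcorner`
(the corner is exactly the fibre of `g₀`) and ONE n-uniform bound per group `g ≠ g₀` (`hGrp`).  This file FIXES the label of record (`grpRec`, `G := Fin 4`,
`g₀ := 3`), proves `hcorner` (`grpRec_eq_three_iff`) and the three fibre identities, and produces `hGrp` (`hGrp_of_rows`) with the constant vector
`cgRec CL C₁ … C₈ := ![Σ_{τ ∈ localFibre} CL τ, 0, C₁ + ⋯ + C₈, 0]` from the three rows' own currencies — so that the END's rest debt reads, by name: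
(LOCAL) one bound per local word; (Λ) the covariance letters and Λ₂ sockets; (N) eight table rows.  Plugging `grpRec_eq_three_iff` and `hGrp_of_rows` into
p252741 is a one-line application left to the consumer (no restatement of its thirty-odd binders here).

CONTENT.
* §1 [our object] **`grpRec`**, `localFibre` (`mem_localFibre`); [folklore] `cornerIdx_not_mem_lamFibre`, `cornerIdx_not_mem_needleFibre'`, **`grpRec_eq_three_iff`** (= `hcorner`),
  **`filter_grpRec_eq_one`** (`= lamFibre`), **`grpRec_eq_two_iff`** (`↔ ∈ needleFibre'`), **`filter_grpRec_eq_zero`** (`= localFibre`).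
* §2 [folklore] **`abs_gLoc_row_le_of_words`** — at a fixed block size: the LOCAL group row from one bound per local word (regroup under the full sum by
  `Assembly.fullSum_finset_sum` with `AssemblyEndRecut.conv_recut`, swap the finite sums, triangle inequality).
* §3 [our object] `cgRec` (`cgRec_zero`∕`_one`∕`_two`); [folklore] **`hGrp_of_rows`** — IN THE END's CURRENCY: `∀ n ≥ 2, [NeZero n] → ∀ g ≠ 3, |row g| ≤ cgRec … g`.
Unit `b2b-balaban-beta-d1-p2` (gen 9), road «BF-x» OWNER, BINDER-OWNERS row D1 co-owner.
-/

noncomputable section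

open Finset Filter Topology
open scoped BigOperators
open Literature.MathematicalPhysics.QuantumFieldTheory.Balaban1983to89
open Literature.MathematicalPhysics.QuantumFieldTheory.Balaban1983to89.Beta
open WindowIdentification (fullSum psum)
open B12Sec2to5 (l1)
open DyadicShell (Pt toReal)
open ExpKernelCalculus (Site MKer BiLoc shiftK comp)
open DressedMomentNormalisation (resSite)
open OneStepResolventKernel (KInv)
open InterLevelTransport (onLat)
open BalabanStepJets (lamCoeffOf)
open AveragingHessianKernels (hessFF)
open KernelWard (divV)
open Summit.QuantumFields.BalabanUV.Beta.TameKernelCalculus (Spr Loc trK)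
open Summit.QuantumFields.BalabanUV.Beta.D1BFx.GluonLeg (Ga)
open Summit.QuantumFields.BalabanUV.Beta.D1BFx.GhostLeg (Ggh)
open Summit.QuantumFields.BalabanUV.Beta.D1BFx.GhostStencil (ghCur)
open Summit.QuantumFields.BalabanUV.Beta.D1BFx.GhostStencilRooted (qAntiAt)
open Summit.QuantumFields.BalabanUV.Beta.D1BFx.GhostStencilRootedReflection (ctrHalf)
open Summit.QuantumFields.BalabanUV.Beta.D1BFx.ReducedKernel (TableR)
open Summit.QuantumFields.BalabanUV.Beta.D1BFx.DressedTadpoleTable (tadpoleTable)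
open Summit.QuantumFields.BalabanUV.Beta.D1BFx.DressedTablesLeg (tadpoleTableA)
open Summit.QuantumFields.BalabanUV.Beta.D1BFx.FineHessianSectors (biBubbleTable)
open Summit.QuantumFields.BalabanUV.Beta.D1BFx.SectorRecut (SbT SbRc)
open Summit.QuantumFields.BalabanUV.Beta.D1BFx.FineStencilBF (ffOf)
open Summit.QuantumFields.BalabanUV.Beta.D1BFx.FineStencilBFBalaban (SbfBal)
open Summit.QuantumFields.BalabanUV.Beta.D1BFx.GhostAveragingSquare (WghAt)
open Summit.QuantumFields.BalabanUV.Beta.D1BFx.FrozenLegProfile (gfrz decay_gfrz)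
open Summit.QuantumFields.BalabanUV.Beta.D1BFx.SplitInstance (RestIdx)
open Summit.QuantumFields.BalabanUV.Beta.D1BFx.SplitRecut (restK')
open Summit.QuantumFields.BalabanUV.Beta.D1BFx.RoadEndBFxRecut (cornerIdx)
open Summit.QuantumFields.BalabanUV.Beta.D1BFx.Assembly (fullSum_finset_sum)
open Summit.QuantumFields.BalabanUV.Beta.D1BFx.AssemblyEndRecut (conv_recut)
open Summit.QuantumFields.BalabanUV.Beta.D1BFx.LamGroupPointwise (lamFibre not_mem_lamFibre_inr_inr)
open Summit.QuantumFields.BalabanUV.Beta.D1BFx.NeedleGroupPointwise (needleFibre' not_mem_needleFibre'_last disjoint_lamFibre_needleFibre')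
open Summit.QuantumFields.BalabanUV.Beta.D1BFx.RoadEndLamRow (abs_gLam_row_le_zero_of_letters)
open Summit.QuantumFields.BalabanUV.Beta.D1BFx.NeedleRowGlue (abs_gN_row_le_of_tables)

namespace Summit.QuantumFields.BalabanUV.Beta.D1BFx.RoadEndBFxRows

/-! ## §1 The label of record and its fibres -/

/-- [our object] **THE LABEL OF RECORD OF THE RE-CUT REST WORDS** (owner SPEC «K-END-RESHAPE-GROUPS» §2, rulings ρ-g9-18∕ρ-g9-26): `1` on the Λ-fibre `lamFibre`,
`2` on the needle fibre of record `needleFibre'`, `3` on the corner word, `0` (LOCAL) elsewhere.  A DEFINITION (data). -/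
def grpRec (τ : RestIdx) : Fin 4 :=
  if τ ∈ lamFibre then 1 else if τ ∈ needleFibre' then 2 else if τ = cornerIdx then 3 else 0

/-- [our object] The LOCAL fibre: every rest word that is neither a Λ-word, nor a needle word, nor the corner. -/
def localFibre : Finset RestIdx :=
  (univ : Finset RestIdx).filter fun τ => grpRec τ = 0

/-- [folklore] The corner word is not a Λ-word. -/
theorem cornerIdx_not_mem_lamFibre : cornerIdx ∉ lamFibre :=
  not_mem_lamFibre_inr_inr _

/-- [folklore] The corner word is not a needle word. -/
theorem cornerIdx_not_mem_needleFibre' : cornerIdx ∉ needleFibre' :=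
  not_mem_needleFibre'_last 0

/-- [folklore] **THE CORNER IS EXACTLY THE FIBRE OF `3`** (the END's datum `hcorner` for the label of record). -/
theorem grpRec_eq_three_iff (τ : RestIdx) : grpRec τ = 3 ↔ τ = cornerIdx := by
  unfold grpRec
  split_ifs with h1 h2 h3
  · exact ⟨fun h => absurd h (by decide), fun h => absurd h1 (h ▸ cornerIdx_not_mem_lamFibre)⟩
  · exact ⟨fun h => absurd h (by decide), fun h => absurd h2 (h ▸ cornerIdx_not_mem_needleFibre')⟩
  · exact ⟨fun _ => h3, fun _ => rfl⟩
  · exact ⟨fun h => absurd h (by decide), fun h => absurd h h3⟩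

/-- [folklore] **THE FIBRE OF `1` IS THE Λ-FIBRE** (`RoadEndLamRow`'s datum `hfib`). -/
theorem filter_grpRec_eq_one : (univ : Finset RestIdx).filter (fun τ => grpRec τ = 1) = lamFibre := by
  ext τ
  simp only [mem_filter, mem_univ, true_and]
  unfold grpRec
  split_ifs with h1 h2 h3
  · exact ⟨fun _ => h1, fun _ => rfl⟩
  · exact ⟨fun h => absurd h (by decide), fun h => absurd h h1⟩
  · exact ⟨fun h => absurd h (by decide), fun h => absurd h h1⟩
  · exact ⟨fun h => absurd h (by decide), fun h => absurd h h1⟩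

/-- [folklore] **THE FIBRE OF `2` IS THE NEEDLE FIBRE OF RECORD** (`NeedleRowGlue`'s datum `hfib`). -/
theorem grpRec_eq_two_iff (τ : RestIdx) : grpRec τ = 2 ↔ τ ∈ needleFibre' := by
  unfold grpRec
  split_ifs with h1 h2 h3
  · exact ⟨fun h => absurd h (by decide), fun h => ((disjoint_left.1 disjoint_lamFibre_needleFibre') h1 h).elim⟩
  · exact ⟨fun _ => h2, fun _ => rfl⟩
  · exact ⟨fun h => absurd h (by decide), fun h => absurd h h2⟩
  · exact ⟨fun h => absurd h (by decide), fun h => absurd h h2⟩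

/-- [our object] **THE FIBRE OF `0` IS THE LOCAL FIBRE** (by definition). -/
theorem filter_grpRec_eq_zero : (univ : Finset RestIdx).filter (fun τ => grpRec τ = 0) = localFibre := rfl

/-- [folklore] **MEMBERSHIP IN THE LOCAL FIBRE**: neither a Λ-word, nor a needle word, nor the corner. -/
theorem mem_localFibre (τ : RestIdx) : τ ∈ localFibre ↔ (τ ∉ lamFibre ∧ τ ∉ needleFibre' ∧ τ ≠ cornerIdx) := by
  rw [localFibre, mem_filter]
  simp only [mem_univ, true_and]
  unfold grpRec
  split_ifs with h1 h2 h3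
  · exact ⟨fun h => absurd h (by decide), fun h => absurd h1 h.1⟩
  · exact ⟨fun h => absurd h (by decide), fun h => absurd h2 h.2.1⟩
  · exact ⟨fun h => absurd h (by decide), fun h => absurd h3 h.2.2⟩
  · exact ⟨fun _ => ⟨h1, h2, h3⟩, fun _ => rfl⟩

/-! ## §2 The LOCAL group row from one bound per local word, at a fixed block size -/

section Fixed

variable (n : ℕ) [NeZero n] (a : ℝ) {gp : Pt → Pt → ℝ} (cE cΛ cR cK cQ cE₂ cJ4 cΛ₂ cR₂ cQ₂ x₀ ωgl ωgh lam N : ℝ) {WE WJ WΛ WR WQ : TableR}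
  {μ ν : Fin 4} {CE CJ CΛt CRt CQ δW : ℝ}

/-- [folklore] **THE LOCAL GROUP ROW FROM PER-WORD ROWS** (site-dependent profile `gp b` exponentially bounded; the (CONV) data of `AssemblyEndRecut.conv_recut`:
`0 < a`, `Spr (Ga n a)`, the five slot tables bi-localised at one rate, `μ ≠ ν`): one bound `CL τ` per local word gives the group bound `Σ_{τ ∈ localFibre} CL τ`. -/
theorem abs_gLoc_row_le_of_words (ha : 0 < a) (hGa : Spr (Ga n a))
    (hg : ∀ b : Pt, ∃ C δ : ℝ, 0 < δ ∧ ∀ v, |gp b v| ≤ C * Real.exp (-δ * l1 v)) (hδW : 0 < δW)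
    (hE : ∀ κ u l u', BiLoc (WE κ u l u') u u' CE δW) (hJ : ∀ κ u l u', BiLoc (WJ κ u l u') u u' CJ δW)
    (hΛ : ∀ κ u l u', BiLoc (WΛ κ u l u') u u' CΛt δW) (hR : ∀ κ u l u', BiLoc (WR κ u l u') u u' CRt δW)
    (hQ : ∀ κ u l u', BiLoc (WQ κ u l u') u u' CQ δW) (hμν : μ ≠ ν) {CL : RestIdx → ℝ}
    (hLoc : ∀ τ ∈ localFibre, |∑ b ∈ (univ : Finset (Fin 4 → Fin n)).image resSite, ((n : ℝ) ^ 4)⁻¹ *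
      fullSum (fun w : Pt => restK' n a (gp b) cE cΛ cR cK cQ cE₂ cJ4 cΛ₂ cR₂ cQ₂ x₀ WE WJ WΛ WR WQ ωgl ωgh lam N μ ν b τ w)| ≤ CL τ) :
    |∑ b ∈ (univ : Finset (Fin 4 → Fin n)).image resSite, ((n : ℝ) ^ 4)⁻¹ *
      fullSum (fun w : Pt => ∑ τ ∈ (univ : Finset RestIdx).filter (fun τ => grpRec τ = 0),
        restK' n a (gp b) cE cΛ cR cK cQ cE₂ cJ4 cΛ₂ cR₂ cQ₂ x₀ WE WJ WΛ WR WQ ωgl ωgh lam N μ ν b τ w)|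
      ≤ ∑ τ ∈ localFibre, CL τ := by
  rw [filter_grpRec_eq_zero]
  have hfs : ∀ b ∈ (univ : Finset (Fin 4 → Fin n)).image resSite,
      fullSum (fun w : Pt => ∑ τ ∈ localFibre, restK' n a (gp b) cE cΛ cR cK cQ cE₂ cJ4 cΛ₂ cR₂ cQ₂ x₀ WE WJ WΛ WR WQ ωgl ωgh lam N μ ν b τ w)
        = ∑ τ ∈ localFibre, fullSum (fun w : Pt => restK' n a (gp b) cE cΛ cR cK cQ cE₂ cJ4 cΛ₂ cR₂ cQ₂ x₀ WE WJ WΛ WR WQ ωgl ωgh lam N μ ν b τ w) := by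
    intro b _
    obtain ⟨C', δ', hδ', hgb⟩ := hg b
    exact fullSum_finset_sum _ fun τ _ =>
      conv_recut n a cE cΛ cR cK cQ cE₂ cJ4 cΛ₂ cR₂ cQ₂ x₀ ωgl ωgh lam N b ha hGa hδ' hgb hδW hE hJ hΛ hR hQ hμν τ
  rw [sum_congr rfl fun b hb => by rw [hfs b hb, mul_sum], sum_comm]
  exact (abs_sum_le_sum_abs _ _).trans (sum_le_sum fun τ hτ => hLoc τ hτ)

end Fixed

/-! ## §3 In the END's currency: `hGrp` for the label of record, from the three rows -/

/-- [our object] The constant vector of the label of record: LOCAL `Σ_{τ ∈ localFibre} CL τ`, G_Λ `0`, NEEDLES `C₁ + ⋯ + C₈`, corner `0` (unused). -/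
def cgRec (CL : RestIdx → ℝ) (C₁ C₂ C₃ C₄ C₅ C₆ C₇ C₈ : ℝ) : Fin 4 → ℝ :=
  ![∑ τ ∈ localFibre, CL τ, 0, C₁ + C₂ + C₃ + C₄ + C₅ + C₆ + C₇ + C₈, 0]

/-- [our object] Unfolding: the LOCAL constant. -/
theorem cgRec_zero (CL : RestIdx → ℝ) (C₁ C₂ C₃ C₄ C₅ C₆ C₇ C₈ : ℝ) : cgRec CL C₁ C₂ C₃ C₄ C₅ C₆ C₇ C₈ 0 = ∑ τ ∈ localFibre, CL τ := by
  simp [cgRec]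

/-- [our object] Unfolding: the G_Λ constant is `0`. -/
theorem cgRec_one (CL : RestIdx → ℝ) (C₁ C₂ C₃ C₄ C₅ C₆ C₇ C₈ : ℝ) : cgRec CL C₁ C₂ C₃ C₄ C₅ C₆ C₇ C₈ 1 = 0 := by
  simp [cgRec]

/-- [our object] Unfolding: the needle constant. -/
theorem cgRec_two (CL : RestIdx → ℝ) (C₁ C₂ C₃ C₄ C₅ C₆ C₇ C₈ : ℝ) :
    cgRec CL C₁ C₂ C₃ C₄ C₅ C₆ C₇ C₈ 2 = C₁ + C₂ + C₃ + C₄ + C₅ + C₆ + C₇ + C₈ := by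
  simp [cgRec]

section Packaged

variable {a N : ℝ} {μ ν : Fin 4} {cE cVH cΛ cR cK cQ cE₂ cJ4 cΛ₂ cR₂ cQ₂ x₀ ωgl ωgh : ℕ → ℝ} {WE WJ WΛ WR WQ : ℕ → TableR}
  {CE CJ CΛt CRt CQ δW : ℕ → ℝ}
  {TΛ WA : ℕ → Fin 4 → Site 4 → Fin 4 → Site 4 → MKer 4 (Fin 4)} {CT δT : ℕ → ℝ}
  {ε : ℕ → ℝ} {X : ℕ → Site 4 → MKer 4 (Fin 4)} {Cx δx : ℕ → ℝ}

/-- [folklore] **ROAD BF-x, THE `hGrp` HYPOTHESIS OF THE END OF RECORD FOR THE LABEL OF RECORD, FROM THE THREE ROWS** (owner «END-ROWS»).  Displayed and NOT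
proved here: the ENDs' common data (`0 < a`, `μ ≠ ν`, `Spr (Ga n a)` along `n`, the five slot tables bi-localised); (LOCAL) one n-uniform bound per local word
`hLoc`; (Λ) the Λ₂-slot structure sockets `hdec`∕`hTloc`∕`hWAa`∕`hWAl`∕`hTcov` and the zero-momentum data `cΛ n ≠ 0`, `ε n = ±1`, `hX`, the covariance letters
(W1) for `ε n • SbfBal` and (W2′) for `−(ε n·cΛ₂ n∕cΛ n) • TΛ n m 0` — as in `RoadEndLamRow.abs_gLam_row_le_zero_of_letters`, along `n`; (N) the eight table rows
`h₁ … h₈` of `NeedleRowGlue.abs_gN_row_le_of_tables`.  Conclusion: `hGrp` of `RoadEndBFxTotalShellGroups.d1Drift_BFx_total_shell_of_prop12_of_groups` at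
`grp := grpRec`, `g₀ := 3`, `CG := cgRec CL C₁ … C₈` (together with `hcorner := grpRec_eq_three_iff`).  NOTHING is estimated here. -/
theorem hGrp_of_rows (ha : 0 < a) (hμν : μ ≠ ν) (hGa : ∀ n : ℕ, 2 ≤ n → ∀ [NeZero n], Spr (Ga n a)) (hδW : ∀ n, 0 < δW n)
    (hE : ∀ n κ u l u', BiLoc (WE n κ u l u') u u' (CE n) (δW n)) (hJ : ∀ n κ u l u', BiLoc (WJ n κ u l u') u u' (CJ n) (δW n))
    (hΛ : ∀ n κ u l u', BiLoc (WΛ n κ u l u') u u' (CΛt n) (δW n)) (hR : ∀ n κ u l u', BiLoc (WR n κ u l u') u u' (CRt n) (δW n))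
    (hQ : ∀ n κ u l u', BiLoc (WQ n κ u l u') u u' (CQ n) (δW n))
    -- (LOCAL) one n-uniform bound per local word
    {CL : RestIdx → ℝ}
    (hLoc : ∀ n : ℕ, 2 ≤ n → ∀ [NeZero n], ∀ τ ∈ localFibre, |∑ b ∈ (univ : Finset (Fin 4 → Fin n)).image resSite, ((n : ℝ) ^ 4)⁻¹ *
      fullSum (fun w : Pt => restK' n a (gfrz n a b) (cE n) (cΛ n) (cR n) (cK n) (cQ n) (cE₂ n) (cJ4 n) (cΛ₂ n) (cR₂ n) (cQ₂ n) (x₀ n)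
        (WE n) (WJ n) (WΛ n) (WR n) (WQ n) (ωgl n) (ωgh n) ((n : ℝ) ^ 8) N μ ν b τ w)| ≤ CL τ)
    -- (Λ) the Λ₂-slot structure sockets, along `n`
    (hδT : ∀ n, 0 < δT n)
    (hdec : ∀ n : ℕ, 2 ≤ n → ∀ [NeZero n], ∀ κ u l u', WΛ n κ u l u' =
      (∑ m : Fin 4, OneStepResolventKernel.wsum (onLat n (fun y => lamCoeffOf (KInv (N := n) (d := 3)) n m y l u'))
          (fun v => onLat n (fun y => TΛ n m y κ u) v))
      + (∑ m : Fin 4, OneStepResolventKernel.wsum (onLat n (fun y => lamCoeffOf (KInv (N := n) (d := 3)) n m y κ u))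
          (fun v => onLat n (fun y => TΛ n m y l u') v))
      + WA n κ u l u')
    (hTloc : ∀ (n : ℕ) m y κ u, BiLoc (TΛ n m y κ u) ((n : ℤ) • y) ((n : ℤ) • y) (CT n * Real.exp (-δT n * l1 ((n : ℤ) • y - u))) (δT n))
    (hWAa : ∀ n κ u l u', trK (WA n κ u l u') = -WA n κ u l u') (hWAl : ∀ n κ u l u', Loc (WA n κ u l u'))
    (hTcov : ∀ (n : ℕ) m y κ u t, TΛ n m (y + t) κ (u + (n : ℤ) • t) = shiftK (-((n : ℤ) • t)) (TΛ n m y κ u))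
    -- (Λ) the zero-momentum data: `cΛ ≠ 0`, `ε = ±1`, the generator's localisation, the covariance letters (W1), (W2′), along `n`
    (hcΛ : ∀ n : ℕ, 2 ≤ n → cΛ n ≠ 0) (hε : ∀ n : ℕ, ε n = 1 ∨ ε n = -1) (hδx : ∀ n, 0 < δx n) (hX : ∀ n u, BiLoc (X n u) u u (Cx n) (δx n))
    (hW1 : ∀ n : ℕ, 2 ≤ n → ∀ [NeZero n], ∀ u,
      comp (comp (Ga n a) (divV (fun κ v => ε n • SbfBal n a (cE n) (cVH n) (cΛ n) (cR n) (cK n) (cQ n) κ v) u)) (Ga n a) =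
        comp (Ga n a) (X n u) - comp (X n u) (Ga n a))
    (hW2 : ∀ n : ℕ, 2 ≤ n → ∀ [NeZero n], ∀ (m : Fin 4) (u : Site 4),
      divV (fun κ v => (-(ε n * (cΛ₂ n / cΛ n))) • TΛ n m 0 κ v) u = comp (X n u) (ffOf (hessFF n m 0)) - comp (ffOf (hessFF n m 0)) (X n u))
    -- (N) the eight needle table rows
    {C₁ C₂ C₃ C₄ C₅ C₆ C₇ C₈ : ℝ}
    (h₁ : ∀ n : ℕ, 2 ≤ n → ∀ [NeZero n], |ωgl n * cE n * ∑ b ∈ (univ : Finset (Fin 4 → Fin n)).image resSite, ((n : ℝ) ^ 4)⁻¹ * (((n : ℝ) ^ 8)⁻¹ *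
      fullSum (fun w : Pt => toReal w μ * toReal w ν *
        biBubbleTable (Ga n a) (Ga n a) SbT (SbRc n a (cE n) (cR n) (cK n) (cQ n)) μ ν (b + w) b))| ≤ C₁)
    (h₂ : ∀ n : ℕ, 2 ≤ n → ∀ [NeZero n], |ωgl n * cE n * ∑ b ∈ (univ : Finset (Fin 4 → Fin n)).image resSite, ((n : ℝ) ^ 4)⁻¹ * (((n : ℝ) ^ 8)⁻¹ *
      fullSum (fun w : Pt => toReal w μ * toReal w ν *
        biBubbleTable (Ga n a) (Ga n a) (SbRc n a (cE n) (cR n) (cK n) (cQ n)) SbT μ ν (b + w) b))| ≤ C₂)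
    (h₃ : ∀ n : ℕ, 2 ≤ n → ∀ [NeZero n], |ωgl n * ∑ b ∈ (univ : Finset (Fin 4 → Fin n)).image resSite, ((n : ℝ) ^ 4)⁻¹ * (((n : ℝ) ^ 8)⁻¹ *
      fullSum (fun w : Pt => toReal w μ * toReal w ν *
        biBubbleTable (Ga n a) (Ga n a) (SbRc n a (cE n) (cR n) (cK n) (cQ n)) (SbRc n a (cE n) (cR n) (cK n) (cQ n)) μ ν (b + w) b))| ≤ C₃)
    (h₄ : ∀ n : ℕ, 2 ≤ n → ∀ [NeZero n], |ωgh n * (cK n * cQ n) * ∑ b ∈ (univ : Finset (Fin 4 → Fin n)).image resSite, ((n : ℝ) ^ 4)⁻¹ *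
      (((n : ℝ) ^ 8)⁻¹ * fullSum (fun w : Pt => toReal w μ * toReal w ν *
        biBubbleTable (Ggh n a) (Ggh n a) ghCur (qAntiAt (ctrHalf n) n) μ ν (b + w) b))| ≤ C₄)
    (h₅ : ∀ n : ℕ, 2 ≤ n → ∀ [NeZero n], |ωgh n * (cQ n * cK n) * ∑ b ∈ (univ : Finset (Fin 4 → Fin n)).image resSite, ((n : ℝ) ^ 4)⁻¹ *
      (((n : ℝ) ^ 8)⁻¹ * fullSum (fun w : Pt => toReal w μ * toReal w ν *
        biBubbleTable (Ggh n a) (Ggh n a) (qAntiAt (ctrHalf n) n) ghCur μ ν (b + w) b))| ≤ C₅)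
    (h₆ : ∀ n : ℕ, 2 ≤ n → ∀ [NeZero n], |ωgh n * (cQ n * cQ n) * ∑ b ∈ (univ : Finset (Fin 4 → Fin n)).image resSite, ((n : ℝ) ^ 4)⁻¹ *
      (((n : ℝ) ^ 8)⁻¹ * fullSum (fun w : Pt => toReal w μ * toReal w ν *
        biBubbleTable (Ggh n a) (Ggh n a) (qAntiAt (ctrHalf n) n) (qAntiAt (ctrHalf n) n) μ ν (b + w) b))| ≤ C₆)
    (h₇ : ∀ n : ℕ, 2 ≤ n → ∀ [NeZero n], |ωgh n * ∑ b ∈ (univ : Finset (Fin 4 → Fin n)).image resSite, ((n : ℝ) ^ 4)⁻¹ * (((n : ℝ) ^ 8)⁻¹ *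
      fullSum (fun w : Pt => toReal w μ * toReal w ν *
        tadpoleTableA (Ggh n a) (WghAt (ctrHalf n) n (x₀ n) (cK n) (cQ n)) μ ν (b + w) b))| ≤ C₇)
    (h₈ : ∀ n : ℕ, 2 ≤ n → ∀ [NeZero n], |ωgl n * cQ₂ n * ∑ b ∈ (univ : Finset (Fin 4 → Fin n)).image resSite, ((n : ℝ) ^ 4)⁻¹ * (((n : ℝ) ^ 8)⁻¹ *
      fullSum (fun w : Pt => toReal w μ * toReal w ν * tadpoleTable n a (WQ n) μ ν (b + w) b))| ≤ C₈) :
    ∀ n : ℕ, 2 ≤ n → ∀ [NeZero n], ∀ g : Fin 4, g ≠ 3 →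
      |∑ b ∈ (univ : Finset (Fin 4 → Fin n)).image resSite, ((n : ℝ) ^ 4)⁻¹ *
        fullSum (fun w : Pt => ∑ τ ∈ (univ : Finset RestIdx).filter (fun τ => grpRec τ = g),
          restK' n a (gfrz n a b) (cE n) (cΛ n) (cR n) (cK n) (cQ n) (cE₂ n) (cJ4 n) (cΛ₂ n) (cR₂ n) (cQ₂ n) (x₀ n)
            (WE n) (WJ n) (WΛ n) (WR n) (WQ n) (ωgl n) (ωgh n) ((n : ℝ) ^ 8) N μ ν b τ w)| ≤ cgRec CL C₁ C₂ C₃ C₄ C₅ C₆ C₇ C₈ g := by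
  intro n hn _
  -- (LOCAL)
  have h0 := abs_gLoc_row_le_of_words n a (cE n) (cΛ n) (cR n) (cK n) (cQ n) (cE₂ n) (cJ4 n) (cΛ₂ n) (cR₂ n) (cQ₂ n) (x₀ n) (ωgl n) (ωgh n)
    ((n : ℝ) ^ 8) N ha (hGa n hn) (fun b => decay_gfrz (hGa n hn) b) (hδW n) (hE n) (hJ n) (hΛ n) (hR n) (hQ n) hμν (hLoc n hn)
  -- (G_Λ)
  have h1 := abs_gLam_row_le_zero_of_letters n a (cE n) (cVH n) (cΛ n) (cR n) (cK n) (cQ n) (cE₂ n) (cJ4 n) (cΛ₂ n) (cR₂ n) (cQ₂ n) (x₀ n)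
    (WE n) (WJ n) (WΛ n) (WR n) (WQ n) (ωgl n) (ωgh n) ((n : ℝ) ^ 8) N μ ν ha (hGa n hn) (hδW n) (hΛ n) (hδT n) (hdec n hn) (hTloc n)
    (hWAa n) (hWAl n) (hTcov n) (hcΛ n hn) (hε n) (hδx n) (hX n) (hW1 n hn) (hW2 n hn) filter_grpRec_eq_one
  -- (NEEDLES ∪ G_R)
  have h2 := abs_gN_row_le_of_tables (N := N) (cΛ := cΛ) (cE₂ := cE₂) (cJ4 := cJ4) (cΛ₂ := cΛ₂) (cR₂ := cR₂) (WE := WE) (WJ := WJ)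
    (WΛ := WΛ) (WR := WR) grpRec_eq_two_iff ha hGa hδW hQ h₁ h₂ h₃ h₄ h₅ h₆ h₇ h₈ n hn
  rw [← cgRec_zero CL C₁ C₂ C₃ C₄ C₅ C₆ C₇ C₈] at h0
  rw [← cgRec_one CL C₁ C₂ C₃ C₄ C₅ C₆ C₇ C₈] at h1
  rw [← cgRec_two CL C₁ C₂ C₃ C₄ C₅ C₆ C₇ C₈] at h2
  intro g hg
  fin_cases g
  · exact h0
  · exact h1
  · exact h2
  · exact absurd rfl hg

end Packaged

end Summit.QuantumFields.BalabanUV.Beta.D1BFx.RoadEndBFxRows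

end
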